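import Summits.Ventures.Crystal3D.Theorems.StickyWulffConstantGenericWallFloorSigma27Cross
import Summits.Ventures.Crystal3D.Theorems.StickyWulffConstantGenericWallFloorSigma9Full
import Summits.Ventures.Crystal3D.Theorems.StickyWulffConstantGenericWallFloorInPlaneTwinStarPairHolds
import Summits.Ventures.Crystal3D.Theorems.StickyWulffConstantGenericWallFloorCoreResidual
import HarnessLib

/-!
# `GenericWallFloor` at FULL charge `c₀ = 1` on the `Σ27` cell `(1,1)`, modulo `ExactOnly`(C12-55) and `StarPairFar`
# (crux `GenericWallFloor`, stmt-Ventures-19480, line `WallLedgerG`)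

HONEST FRAMING. Venture `Summits/Ventures/Crystal3D` (cell `crystal3d-full`), helper `--supports` the crux
`GenericWallFloor` of `route-Ventures-StickyWulffConstant`, REGISTERED line `WallLedgerG`, open stub
`stub_twoSlabAdhesion`.  Rung credit only; F-C1 not moved; NOT the crux: the certified inputs `ExactOnly`(C12-55) [E1]
and `StarPairFar` remain BY NAME (the stars-only input `InPlaneTwinStarPair` is a tree theorem and is discharged here).

**`genericWallFloorAtCharge_one_sigma27`.**  For a `Σ27` pair `A₂·Λ₀ = (wordFrame A₁ [μ₃, μ₂, μ₁])·Λ₀` (reduced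
three-letter model menu word), steep slots `u₁` (up, grain 1) and `u₂` (down, grain 2), and the level-two conditions of
cell `(l,c) = (1,1)` on BOTH forced rays in their two readings (`hsecond₁/hcap₁` at `z₁ = e₃`: if grain 1 pushes through
plane `μ₁` its best capper does not force plane `μ₂` / lies in plane `μ₂`; `hsecond₂/hcap₂` at `z₂ = -e₃`, the same for
grain 2 through plane `μ₃`): `GenericWallFloorAtCharge 1 A₁ t₁ A₂ t₂` — the matrix of the route decl for the pair,
verbatim, at the crux's own constant — and hence `GenericWallFloorAt A₁ t₁ A₂ t₂`.  Mechanism: the separation-free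
ledger `twoSlabAdhesion_stackLedger_cross`; by `inPlaneTwin_of_coaxial_sigma27` the only co-axial cross pair of walker
tops is the in-plane twin pair about the middle plane, priced by `inPlaneTwinStarPair_holds`; arrivals
(`hfar₁/hfar₂`) are excluded by the same lemma applied against the bare bottom of the other grain plus
`image_twinFrame_ne`.  Numerically (seat folder `calc/cells_k3.py`) cell `(1,1)` is `≈ 9.5 %` of Haar `Σ27`
orientations, on top of the `71 %` (cells `l + c ≤ 1`) separated two-sidedly by 19480-p2 g4.
WHAT THIS IS NOT: not the stub; cells `(0,2)/(2,0)/(2,·)` of `Σ27` (level-three word law) are untouched; F-C1 not moved.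
-/

noncomputable section

namespace Summit.Ventures.Crystal3D.Theorems

open Summit.Ventures.Crystal3D Finset
open Literature.MathematicalPhysics.StatisticalMechanics (fccStacking barlowStacking IsHaggSeq contactDeficiency)
open scoped InnerProductSpace

open scoped Classical in
/-- **`GenericWallFloor` per pair at FULL charge on the `Σ27` cell `(1,1)`**, modulo `ExactOnly`(C12-55) and
`StarPairFar`.  See the module docstring. -/
theorem genericWallFloorAtCharge_one_sigma27
    {s₀ : EuclideanSpace ℝ (Fin 3)} (hs₀ : s₀ ∈ fccSlots)
    (hcert : ExactOnly 0 (fccSlots.filter fun w => 0 < ⟪w, s₀⟫_ℝ)) (hfar : StarPairFar)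
    (A₁ : EuclideanSpace ℝ (Fin 3) ≃ₗᵢ[ℝ] EuclideanSpace ℝ (Fin 3)) (t₁ : EuclideanSpace ℝ (Fin 3))
    (A₂ : EuclideanSpace ℝ (Fin 3) ≃ₗᵢ[ℝ] EuclideanSpace ℝ (Fin 3)) (t₂ : EuclideanSpace ℝ (Fin 3))
    {u₁ : EuclideanSpace ℝ (Fin 3)} (hu₁ : u₁ ∈ fccSlots)
    (hsteep₁ : Real.sqrt 2 / 2 ≤ ⟪A₁ u₁, EuclideanSpace.single (2 : Fin 3) (1 : ℝ)⟫_ℝ)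
    {u₂ : EuclideanSpace ℝ (Fin 3)} (hu₂ : u₂ ∈ fccSlots)
    (hsteep₂ : ⟪A₂ u₂, EuclideanSpace.single (2 : Fin 3) (1 : ℝ)⟫_ℝ ≤ -(Real.sqrt 2 / 2))
    (μ₃ μ₂ μ₁ : EuclideanSpace ℝ (Fin 3))
    (hκl : ∀ μ ∈ [μ₃, μ₂, μ₁], ‖μ‖ = 1 ∧
      ∀ w ∈ fccSlots, ⟪w, μ⟫_ℝ = 0 ∨ ⟪w, μ⟫_ℝ = Real.sqrt (2 / 3) ∨ ⟪w, μ⟫_ℝ = -Real.sqrt (2 / 3))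
    (hκc : List.IsChain (fun μ μ' => ⟪μ, μ'⟫_ℝ = 1 / 3 ∨ ⟪μ, μ'⟫_ℝ = -1 / 3) [μ₃, μ₂, μ₁])
    (hA₂ : A₂ '' fccStacking 1 (Real.sqrt (2 / 3)) = (wordFrame A₁ [μ₃, μ₂, μ₁]) '' fccStacking 1 (Real.sqrt (2 / 3)))
    (hsecond₁ : ∀ n₁ : EuclideanSpace ℝ (Fin 3), (n₁ = A₁ μ₁ ∨ n₁ = -A₁ μ₁) → ⟪A₁ u₁, n₁⟫_ℝ = Real.sqrt (2 / 3) →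
      ∀ q ∈ fccSlots, 0 < ⟪twinFrame A₁ n₁ q, n₁⟫_ℝ →
        (∀ q' ∈ fccSlots, 0 < ⟪twinFrame A₁ n₁ q', n₁⟫_ℝ →
          ⟪twinFrame A₁ n₁ q', EuclideanSpace.single (2 : Fin 3) (1 : ℝ)⟫_ℝ ≤
            ⟪twinFrame A₁ n₁ q, EuclideanSpace.single (2 : Fin 3) (1 : ℝ)⟫_ℝ) →
        (twinFrame A₁ n₁).symm ((2 * Real.sqrt (2 / 3)) • twinFrame A₁ n₁ q - n₁) ≠ μ₂ ∧
        (twinFrame A₁ n₁).symm ((2 * Real.sqrt (2 / 3)) • twinFrame A₁ n₁ q - n₁) ≠ -μ₂)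
    (hcap₁ : ∀ n₁ : EuclideanSpace ℝ (Fin 3), (n₁ = A₁ μ₁ ∨ n₁ = -A₁ μ₁) → ⟪A₁ u₁, n₁⟫_ℝ = Real.sqrt (2 / 3) →
      ∀ q ∈ fccSlots, 0 < ⟪twinFrame A₁ n₁ q, n₁⟫_ℝ →
        (∀ q' ∈ fccSlots, 0 < ⟪twinFrame A₁ n₁ q', n₁⟫_ℝ →
          ⟪twinFrame A₁ n₁ q', EuclideanSpace.single (2 : Fin 3) (1 : ℝ)⟫_ℝ ≤
            ⟪twinFrame A₁ n₁ q, EuclideanSpace.single (2 : Fin 3) (1 : ℝ)⟫_ℝ) →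
        ⟪q, μ₂⟫_ℝ = 0)
    (hsecond₂ : ∀ n₁ : EuclideanSpace ℝ (Fin 3),
      (n₁ = wordFrame A₁ [μ₃, μ₂, μ₁] μ₃ ∨ n₁ = -wordFrame A₁ [μ₃, μ₂, μ₁] μ₃) → ⟪A₂ u₂, n₁⟫_ℝ = Real.sqrt (2 / 3) →
      ∀ q ∈ fccSlots, 0 < ⟪twinFrame A₂ n₁ q, n₁⟫_ℝ →
        (∀ q' ∈ fccSlots, 0 < ⟪twinFrame A₂ n₁ q', n₁⟫_ℝ →
          ⟪twinFrame A₂ n₁ q', -EuclideanSpace.single (2 : Fin 3) (1 : ℝ)⟫_ℝ ≤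
            ⟪twinFrame A₂ n₁ q, -EuclideanSpace.single (2 : Fin 3) (1 : ℝ)⟫_ℝ) →
        (wordFrame A₁ [μ₃, μ₂, μ₁]).symm
            (A₂ ((twinFrame A₂ n₁).symm ((2 * Real.sqrt (2 / 3)) • twinFrame A₂ n₁ q - n₁))) ≠ μ₂ ∧
        (wordFrame A₁ [μ₃, μ₂, μ₁]).symm
            (A₂ ((twinFrame A₂ n₁).symm ((2 * Real.sqrt (2 / 3)) • twinFrame A₂ n₁ q - n₁))) ≠ -μ₂)
    (hcap₂ : ∀ n₁ : EuclideanSpace ℝ (Fin 3),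
      (n₁ = wordFrame A₁ [μ₃, μ₂, μ₁] μ₃ ∨ n₁ = -wordFrame A₁ [μ₃, μ₂, μ₁] μ₃) → ⟪A₂ u₂, n₁⟫_ℝ = Real.sqrt (2 / 3) →
      ∀ q ∈ fccSlots, 0 < ⟪twinFrame A₂ n₁ q, n₁⟫_ℝ →
        (∀ q' ∈ fccSlots, 0 < ⟪twinFrame A₂ n₁ q', n₁⟫_ℝ →
          ⟪twinFrame A₂ n₁ q', -EuclideanSpace.single (2 : Fin 3) (1 : ℝ)⟫_ℝ ≤
            ⟪twinFrame A₂ n₁ q, -EuclideanSpace.single (2 : Fin 3) (1 : ℝ)⟫_ℝ) →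
        ⟪twinFrame A₂ n₁ q, twinFrame A₁ (A₁ μ₁) μ₂⟫_ℝ = 0) :
    GenericWallFloorAtCharge 1 A₁ t₁ A₂ t₂ := by
  set e₃ : EuclideanSpace ℝ (Fin 3) := EuclideanSpace.single (2 : Fin 3) (1 : ℝ) with he₃
  have hsteep₂' : Real.sqrt 2 / 2 ≤ ⟪A₂ u₂, -e₃⟫_ℝ := by rw [inner_neg_right]; linarith only [hsteep₂]
  -- the trivial stacks on both sides
  have hS₀₁ : StackSound e₃ [⟨A₁, u₁, 0⟩] := ⟨hu₁, hsteep₁⟩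
  have hW₀₁ : StackWF e₃ [⟨A₁, u₁, 0⟩] := rfl
  have hS₀₂ : StackSound (-e₃) [⟨A₂, u₂, 0⟩] := ⟨hu₂, hsteep₂'⟩
  have hW₀₂ : StackWF (-e₃) [⟨A₂, u₂, 0⟩] := rfl
  -- (a) no grain-1 stack frame is `A₂·Λ₀`: it would be co-axial with grain 2's bare bottom, hence a twin of itself
  have hfar₁ : ∀ stk : List WalkEntry, StackSound e₃ stk → StackWF e₃ stk → stk.getLast? = some ⟨A₁, u₁, 0⟩ →
      ∀ e ∈ stk, e.frame '' fccStacking 1 (Real.sqrt (2 / 3)) ≠ A₂ '' fccStacking 1 (Real.sqrt (2 / 3)) := by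
    intro stk hS hW hl e he hEq
    obtain ⟨r, hS', hW', hl'⟩ := exists_suffix_of_mem stk e he hS hW
    rw [hl] at hl'
    have hco := coaxial_linear_of_image_eq (F₁ := e.frame) (F₂ := (⟨A₂, u₂, 0⟩ : WalkEntry).frame) hEq
    obtain ⟨ν, hν, hmenu, himg, -, -⟩ := inPlaneTwin_of_coaxial_sigma27 μ₃ μ₂ μ₁ hκl hκc hA₂ hsecond₁ hcap₁
      hsecond₂ hcap₂ hS' hW' hl' hS₀₂ hW₀₂ rfl hco
    exact image_twinFrame_ne e.frame hν hmenu (himg.symm.trans hEq.symm)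
  -- (b) no grain-2 stack frame is `A₁·Λ₀`, symmetrically
  have hfar₂ : ∀ stk : List WalkEntry, StackSound (-e₃) stk → StackWF (-e₃) stk → stk.getLast? = some ⟨A₂, u₂, 0⟩ →
      ∀ e ∈ stk, e.frame '' fccStacking 1 (Real.sqrt (2 / 3)) ≠ A₁ '' fccStacking 1 (Real.sqrt (2 / 3)) := by
    intro stk hS hW hl e he hEq
    obtain ⟨r, hS', hW', hl'⟩ := exists_suffix_of_mem stk e he hS hW
    rw [hl] at hl'
    have hco := coaxial_linear_of_image_eq (F₁ := (⟨A₁, u₁, 0⟩ : WalkEntry).frame) (F₂ := e.frame) hEq.symm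
    obtain ⟨ν, hν, hmenu, himg, -, -⟩ := inPlaneTwin_of_coaxial_sigma27 μ₃ μ₂ μ₁ hκl hκc hA₂ hsecond₁ hcap₁
      hsecond₂ hcap₂ hS₀₁ hW₀₁ rfl hS' hW' hl' hco
    exact image_twinFrame_ne A₁ hν hmenu (himg.symm.trans hEq)
  -- (c) the priced cross pairs: the one co-axial pair is the in-plane twin pair, covered by `inPlaneTwinStarPair_holds`
  have hledger := twoSlabAdhesion_stackLedger_cross hs₀ hcert (doubleStarCoaxialAt_of_starPairFar hfar)
    (capPairCoaxial_of_starPairFar hfar) A₁ t₁ A₂ t₂ hu₁ hsteep₁ hu₂ hsteep₂ hfar₁ hfar₂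
    (fun stk₁ stk₂ e₁ e₂ rest₁ rest₂ hS₁ hW₁ hl₁ hst₁ hS₂ hW₂ hl₂ hst₂ => by
      by_cases hco : ∃ (L : EuclideanSpace ℝ (Fin 3) ≃ₗᵢ[ℝ] EuclideanSpace ℝ (Fin 3))
          (s₁ s₂ : EuclideanSpace ℝ (Fin 3)) (σ σ' : ℤ → ℤ), IsHaggSeq σ ∧ IsHaggSeq σ' ∧
          e₁.frame '' fccStacking 1 (Real.sqrt (2 / 3)) ⊆ (fun p => L p + s₁) '' barlowStacking 1 (Real.sqrt (2 / 3)) σ ∧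
          e₂.frame '' fccStacking 1 (Real.sqrt (2 / 3)) ⊆ (fun p => L p + s₂) '' barlowStacking 1 (Real.sqrt (2 / 3)) σ'
      · right
        subst hst₁; subst hst₂
        obtain ⟨ν, hν, hmenu, himg, hd₁, hd₂⟩ := inPlaneTwin_of_coaxial_sigma27 μ₃ μ₂ μ₁ hκl hκc hA₂ hsecond₁ hcap₁
          hsecond₂ hcap₂ hS₁ hW₁ hl₁ hS₂ hW₂ hl₂ hco
        intro Y hY y hy hown₁ hown₂
        exact ⟨starSet_ne_of_inPlaneTwin hν hmenu himg hS₁.top.1 hd₁,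
          cover_of_inPlaneTwinStarPair inPlaneTwinStarPair_holds hY hν hmenu himg hS₁.top.1 hS₂.top.1 hd₁ hd₂ hy
            hown₁ hown₂⟩
      · exact Or.inl hco)
  -- (d) the skeleton composition and the charge `½(κ₁ + κ₂) ≥ 1`
  have hκ₁ := one_le_flux_of_steep (A := A₁) (u := u₁) (le_trans hsteep₁ (le_abs_self _))
  have hκ₂ : 1 ≤ Real.sqrt 2 * |⟪A₂ u₂, EuclideanSpace.single (2 : Fin 3) (1 : ℝ)⟫_ℝ| := by
    refine one_le_flux_of_steep (A := A₂) (u := u₂) ?_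
    rw [abs_of_nonpos (by linarith only [hsteep₂, Real.sqrt_nonneg 2] :
      ⟪A₂ u₂, EuclideanSpace.single (2 : Fin 3) (1 : ℝ)⟫_ℝ ≤ 0)]
    linarith only [hsteep₂]
  exact genericWallFloorAtCharge_mono (by linarith only [hκ₁, hκ₂])
    (genericWallFloorAtCharge_of_ledger _ A₁ t₁ A₂ t₂ hledger)

open scoped Classical in
/-- **`GenericWallFloorAt` (the route decl's matrix, `c₀ = 1`) on the `Σ27` cell `(1,1)`**, modulo `ExactOnly`(C12-55)
and `StarPairFar`: `genericWallFloorAtCharge_one_sigma27` read through `genericWallFloorAt_of_charge_one`. -/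
theorem genericWallFloorAt_sigma27
    {s₀ : EuclideanSpace ℝ (Fin 3)} (hs₀ : s₀ ∈ fccSlots)
    (hcert : ExactOnly 0 (fccSlots.filter fun w => 0 < ⟪w, s₀⟫_ℝ)) (hfar : StarPairFar)
    (A₁ : EuclideanSpace ℝ (Fin 3) ≃ₗᵢ[ℝ] EuclideanSpace ℝ (Fin 3)) (t₁ : EuclideanSpace ℝ (Fin 3))
    (A₂ : EuclideanSpace ℝ (Fin 3) ≃ₗᵢ[ℝ] EuclideanSpace ℝ (Fin 3)) (t₂ : EuclideanSpace ℝ (Fin 3))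
    {u₁ : EuclideanSpace ℝ (Fin 3)} (hu₁ : u₁ ∈ fccSlots)
    (hsteep₁ : Real.sqrt 2 / 2 ≤ ⟪A₁ u₁, EuclideanSpace.single (2 : Fin 3) (1 : ℝ)⟫_ℝ)
    {u₂ : EuclideanSpace ℝ (Fin 3)} (hu₂ : u₂ ∈ fccSlots)
    (hsteep₂ : ⟪A₂ u₂, EuclideanSpace.single (2 : Fin 3) (1 : ℝ)⟫_ℝ ≤ -(Real.sqrt 2 / 2))
    (μ₃ μ₂ μ₁ : EuclideanSpace ℝ (Fin 3))
    (hκl : ∀ μ ∈ [μ₃, μ₂, μ₁], ‖μ‖ = 1 ∧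
      ∀ w ∈ fccSlots, ⟪w, μ⟫_ℝ = 0 ∨ ⟪w, μ⟫_ℝ = Real.sqrt (2 / 3) ∨ ⟪w, μ⟫_ℝ = -Real.sqrt (2 / 3))
    (hκc : List.IsChain (fun μ μ' => ⟪μ, μ'⟫_ℝ = 1 / 3 ∨ ⟪μ, μ'⟫_ℝ = -1 / 3) [μ₃, μ₂, μ₁])
    (hA₂ : A₂ '' fccStacking 1 (Real.sqrt (2 / 3)) = (wordFrame A₁ [μ₃, μ₂, μ₁]) '' fccStacking 1 (Real.sqrt (2 / 3)))
    (hsecond₁ : ∀ n₁ : EuclideanSpace ℝ (Fin 3), (n₁ = A₁ μ₁ ∨ n₁ = -A₁ μ₁) → ⟪A₁ u₁, n₁⟫_ℝ = Real.sqrt (2 / 3) →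
      ∀ q ∈ fccSlots, 0 < ⟪twinFrame A₁ n₁ q, n₁⟫_ℝ →
        (∀ q' ∈ fccSlots, 0 < ⟪twinFrame A₁ n₁ q', n₁⟫_ℝ →
          ⟪twinFrame A₁ n₁ q', EuclideanSpace.single (2 : Fin 3) (1 : ℝ)⟫_ℝ ≤
            ⟪twinFrame A₁ n₁ q, EuclideanSpace.single (2 : Fin 3) (1 : ℝ)⟫_ℝ) →
        (twinFrame A₁ n₁).symm ((2 * Real.sqrt (2 / 3)) • twinFrame A₁ n₁ q - n₁) ≠ μ₂ ∧
        (twinFrame A₁ n₁).symm ((2 * Real.sqrt (2 / 3)) • twinFrame A₁ n₁ q - n₁) ≠ -μ₂)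
    (hcap₁ : ∀ n₁ : EuclideanSpace ℝ (Fin 3), (n₁ = A₁ μ₁ ∨ n₁ = -A₁ μ₁) → ⟪A₁ u₁, n₁⟫_ℝ = Real.sqrt (2 / 3) →
      ∀ q ∈ fccSlots, 0 < ⟪twinFrame A₁ n₁ q, n₁⟫_ℝ →
        (∀ q' ∈ fccSlots, 0 < ⟪twinFrame A₁ n₁ q', n₁⟫_ℝ →
          ⟪twinFrame A₁ n₁ q', EuclideanSpace.single (2 : Fin 3) (1 : ℝ)⟫_ℝ ≤
            ⟪twinFrame A₁ n₁ q, EuclideanSpace.single (2 : Fin 3) (1 : ℝ)⟫_ℝ) →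
        ⟪q, μ₂⟫_ℝ = 0)
    (hsecond₂ : ∀ n₁ : EuclideanSpace ℝ (Fin 3),
      (n₁ = wordFrame A₁ [μ₃, μ₂, μ₁] μ₃ ∨ n₁ = -wordFrame A₁ [μ₃, μ₂, μ₁] μ₃) → ⟪A₂ u₂, n₁⟫_ℝ = Real.sqrt (2 / 3) →
      ∀ q ∈ fccSlots, 0 < ⟪twinFrame A₂ n₁ q, n₁⟫_ℝ →
        (∀ q' ∈ fccSlots, 0 < ⟪twinFrame A₂ n₁ q', n₁⟫_ℝ →
          ⟪twinFrame A₂ n₁ q', -EuclideanSpace.single (2 : Fin 3) (1 : ℝ)⟫_ℝ ≤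
            ⟪twinFrame A₂ n₁ q, -EuclideanSpace.single (2 : Fin 3) (1 : ℝ)⟫_ℝ) →
        (wordFrame A₁ [μ₃, μ₂, μ₁]).symm
            (A₂ ((twinFrame A₂ n₁).symm ((2 * Real.sqrt (2 / 3)) • twinFrame A₂ n₁ q - n₁))) ≠ μ₂ ∧
        (wordFrame A₁ [μ₃, μ₂, μ₁]).symm
            (A₂ ((twinFrame A₂ n₁).symm ((2 * Real.sqrt (2 / 3)) • twinFrame A₂ n₁ q - n₁))) ≠ -μ₂)
    (hcap₂ : ∀ n₁ : EuclideanSpace ℝ (Fin 3),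
      (n₁ = wordFrame A₁ [μ₃, μ₂, μ₁] μ₃ ∨ n₁ = -wordFrame A₁ [μ₃, μ₂, μ₁] μ₃) → ⟪A₂ u₂, n₁⟫_ℝ = Real.sqrt (2 / 3) →
      ∀ q ∈ fccSlots, 0 < ⟪twinFrame A₂ n₁ q, n₁⟫_ℝ →
        (∀ q' ∈ fccSlots, 0 < ⟪twinFrame A₂ n₁ q', n₁⟫_ℝ →
          ⟪twinFrame A₂ n₁ q', -EuclideanSpace.single (2 : Fin 3) (1 : ℝ)⟫_ℝ ≤
            ⟪twinFrame A₂ n₁ q, -EuclideanSpace.single (2 : Fin 3) (1 : ℝ)⟫_ℝ) →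
        ⟪twinFrame A₂ n₁ q, twinFrame A₁ (A₁ μ₁) μ₂⟫_ℝ = 0) :
    GenericWallFloorAt A₁ t₁ A₂ t₂ :=
  genericWallFloorAt_of_charge_one (genericWallFloorAtCharge_one_sigma27 hs₀ hcert hfar A₁ t₁ A₂ t₂ hu₁ hsteep₁ hu₂
    hsteep₂ μ₃ μ₂ μ₁ hκl hκc hA₂ hsecond₁ hcap₁ hsecond₂ hcap₂)

end Summit.Ventures.Crystal3D.Theorems

end
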